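import Literature.MathematicalPhysics.QuantumFieldTheory.Balaban1983to89.BalabanAdmissibleClassParams
import Literature.MathematicalPhysics.QuantumFieldTheory.Balaban1983to89.T4AveragingDisintegration
import Literature.MathematicalPhysics.QuantumFieldTheory.Balaban1983to89.T4CubeChartExp
import HarnessLib

/-!
# HOME DRAFT v18-texts (ideator ym-r3-idea-1 g27 — the v18 PEN, ★★OWNER №264) — ELABORATION CHECK ONLY, not a row of record.
# S1aᴴ `RunClassMembershipH` · O1ᵘ-H v2 `OneStepTransportUH` · S3ᴴ `BackwardStabilityFinSupH`

Conventions (TN-ANCHOR-FREE + TN-OSC, `GRAnchorFree.lean` 61fb5a2234d356d0; LEAD spec `V18-TYPING-SPEC-w3g24.md` v1.4 §1–§4b; pen 9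
`…OrganTangentSeedHClause` fc939bbb; w4 g22 (P-b′) `…OrganTangentSmallStepChordPath` eef18f76):
* H-CLAUSE WINDOW `θW_i := θBal F.L γ b₀ p₀ i ∕ 4` — every pair clause is the tree's single-parameter text `HClauseSq θW r k R`
  (corners `PlaqSmall θW`, caps `r·θW`, sizes `‖v‖∕θW`), so brick T (✓p797413) and `GRAnchorFree` apply with NO conversion.
  INPUT∕SEED cap `rA∕2` (what pen 9 delivers at `θ := θBal∕2`, `cH = 1∕2`: corners `θBal∕4`, cap `rA·(θBal∕2)∕4 = (rA∕2)·θW`, letters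
  `K·(θBal∕2)²` in sizes `∕(θBal∕2)` = `K·(θBal∕2)²∕4` in sizes `∕θW` — ONE conversion, at the seed, in `runPairSeedH_of_seed`); OUTPUT cap `r` = O1ᵘ-H's own.
* ANALYTICITY (β) clause in block ⑧ (both towers, every height of the block): LEAD §1's `AnalyticPairWindowAt` VERBATIM at window parameter
  `49∕50·θBal` (v0.4 = v18.1 (a′), TN-WINDOW-β: base points cover `supp χ = PlaqSmall (24∕25·θBal)` with margin `θBal∕50` for the displaced grid
  configurations of the pull-back; v0.1–v0.3 had `θBal∕2`; bidisc radius `rA·(49∕50·θBal)`, the prover's witness regime is `rA ≤ 1∕(100·√3)`, the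
  TEXT keeps S1aᴴ's `rA ≤ 1∕12` slack conjunct byte-identical), radius `rA` and profile `Bρ` quantified BEFORE the towers (outer `∀`, with `prm, η`).
* O1ᵘ-H v2 = DIRECT TRANSPORT FROM THE SEED HEIGHT `Ts` to every `j₁ ≤ j < Ts` (v1's stride `(j, m)` with `j + m ≤ Ts` restricted to `j + m = Ts`,
  the only instance the junction uses): INPUT = the marginal-free H-clause for `h_{Ts} := log ρ_{Ts} − log ρ′_{Ts}` with row-mass `w`, cap `rA∕2`
  (v1's `(c, a)` input dropped — v2 is v1 restricted, hence WEAKER); OUTPUT = `(c′, a′, w′, k′)` as v1 on `θW_j`, bound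
  `a′ + θ·x′ ≤ (Ctr + εd (T − (Ts+1)) + C·x)·x + δ j`, `x := w∕(β_{Ts}θ_{Ts}²)` (marginal units; v1's `θ·x ≤ w₀` re-normalised to `x ≤ w₀`).
* S3ᴴ = S3 v17.2's frame (runs on `[T, Tt]`, SF-projections below `T`, block ⑧ on `[j₀, Tt]` += (β)) + H-SEED at `T` (letters `kT`, row-mass
  `wT`, cap `rA∕2`) + `x_T := wT ∕ (β_T·θ_T²) ≤ w₀`; CONCLUSION (TN-OSC) = the inner-window SUP-OSCILLATION relative to `1` at path profile
  `b₀∕8`: `∀ U, PlaqSmall (θBal F.L γ (√(b₀∕8)) (p₀∕2) j) U → |h_j U − h_j 1| ≤ (Cs·x_T + δ j)·V_j`, `V_j := β_j·(2·#Plaq_j + #PBond_j²)` (v0.2) — no ε-schedule,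
  no double tail sums (no iteration), `∃ pW, … pW ≤ p₀` (S4a∕P-b′ regime), `j₁` absorbs P-b′'s `jW` and `θ_j ≤ 1`.
VERSIONS: v0.1 28496b3b (critic #607 PASS-WITH-PRICE) · v0.2 73b67645 (`V_j` θ-free; BC7 5∕5 CLEAN) · v0.5 (this write = v0.4 58f70c6c + ONE token pair «TN-TAIL-P0»:
`∃ pW : ℝ,` before `∃ γ₁` and `pW ≤ p₀ →` after `0 < p₀ →` in the head of O1ᵘ-H v2 ONLY (now v2.2), mirroring S3ᴴ `BackwardStabilityFinSupH`'s own `∃ pW … pW ≤ p₀ →` — the LIN knit's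
supplier `FibreLawH.lean` (B′) carries sub-window fibre-tail profiles that are super-polynomial only for `p₀` above a threshold (ideator g28 №8 (c), LEAD w3 g25
№25 (c)∕№27 (e), ★★OWNER RULING №71 (2)(iv)); S1aᴴ and S3ᴴ texts byte-unchanged; nothing else moves · v0.4 58f70c6c (44402e64 + ONE token family): the
(β) base-window token `(θBal F.L γ b₀ p₀ j / 2)` ↦ `(49 / 50 * θBal F.L γ b₀ p₀ j)` at the five (β) sites (S1aᴴ ×1, O1ᵘ-H v2 ×2, S3ᴴ ×2) = v18.1 (a′) of
record (LEAD w3 g25 №13∕№17, ideator g28 №3 (B)∕№4 (B), ★★OWNER RULING №70∕№362); nothing else moves · v0.3 44402e64: S1aᴴ N2 TEXT-SIDE per LEAD w3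
g24 №15 (A) — `… ∧ 0 < rA ∧ rA ≤ 1 ∕ 12 ∧ 0 < CB ∧ …` (two conjuncts; O1ᵘ-H v2 ∕ S3ᴴ texts byte-identical to v0.2) + route-independent imports (lit
`BalabanAdmissibleClassParams` + `T4AveragingDisintegration` instead of `…OneStepBackwardContractionAdmDescentDisintegration`; px19 g18 rehearsal v4).
HONEST: typing drafts; nothing of Bałaban's asserted; whether the runs' densities inhabit (β)∕the H-clauses is print's claim (UV3 p.263 (c)), not
formalised; O1∕O1ᵘ-H∕S3ᴴ∕crux 20520∕`YM3TorusSU2` NOT proved; registry v11.4 №36 + `Lines/runpair_organ.lean` v17.2 untouched; R3 = SU(2) YM₃ on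
T³ at fixed lattice data — NOT d = 4, NOT infinite volume, NOT a mass gap, NOT Clay.
-/

set_option autoImplicit false

open MeasureTheory Filter Topology
open Literature.MathematicalPhysics.QuantumFieldTheory.Balaban1983to89 T3ContinuumYM3Torus T3NestedUnitLaws
  T3UnitLawDensityEML T4Continuum BalabanUVClass T3UnitScaleTilt
open T4CubeChartExp (expPt)
open scoped BigOperators

namespace Summit.QuantumFields.YangMills.Cruxes.FluctuationComparisonRegPrIntL.V18Draft

/-- sfCut, R-CUT-χ token of record (byte-identical with runpair_organ v17.2 :166). -/
noncomputable def sfCut {P : Params} {k : ℕ} (θ : ℝ) (U : GaugeField P k ↥(Matrix.specialUnitaryGroup (Fin 2) ℂ)) : ℝ :=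
  ∏ p : Plaq P k, max 0 (min 1 ((24 / 25 * θ - dist1 (GaugeField.plaqHol U p)) / ((24 / 25 - 1 / 2) * θ)))

/-- `HClauseSq θ r k R` · THE SCALED ONE-BOND-PAIR CLAUSE (tree text: ✓p797413 `firstDiff_window_path`'s hypothesis `h`, byte-identical body). -/
def HClauseSq {P : Params} {j : ℕ} (θ r : ℝ) (k : PBond P j → PBond P j → ℝ)
    (R : GaugeField P j ↥(Matrix.specialUnitaryGroup (Fin 2) ℂ) → ℝ) : Prop :=
  ∀ (b b' : PBond P j) (v v' : Fin 3 → ℝ) (U V W Z : GaugeField P j ↥(Matrix.specialUnitaryGroup (Fin 2) ℂ)),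
    ‖v‖ ≤ r * θ → ‖v'‖ ≤ r * θ → PlaqSmall θ U → PlaqSmall θ V → PlaqSmall θ W → PlaqSmall θ Z →
    (∀ e, e ≠ b → V e = U e) → V b = U b * expPt v → (∀ e, e ≠ b' → W e = U e) → W b' = U b' * expPt v' →
    (∀ e, e ≠ b' → Z e = V e) → Z b' = V b' * expPt v' →
    |R Z - R V - R W + R U| ≤ k b b' * (‖v‖ / θ) * (‖v'‖ / θ)

/-- `AnalyticPairWindowAt θ r B f` · THE ANALYTICITY PREDICATE (β) — LEAD spec §1 text VERBATIM ([Balaban1985UV3] p.263 (c)): an INTERFACE. -/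
def AnalyticPairWindowAt {P : Params} {j : ℕ} (θ r B : ℝ) (f : GaugeField P j ↥(Matrix.specialUnitaryGroup (Fin 2) ℂ) → ℝ) : Prop :=
  ∀ (U : GaugeField P j ↥(Matrix.specialUnitaryGroup (Fin 2) ℂ)), PlaqSmall θ U →
    ∀ (b b' : PBond P j) (v v' : Fin 3 → ℝ), ‖v‖ ≤ 1 → ‖v'‖ ≤ 1 →
      ∃ g : ℂ × ℂ → ℂ, DifferentiableOn ℂ g (Metric.ball (0 : ℂ) (r * θ) ×ˢ Metric.ball (0 : ℂ) (r * θ)) ∧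
        (∀ (s t : ℝ) (V Z : GaugeField P j ↥(Matrix.specialUnitaryGroup (Fin 2) ℂ)), |s| < r * θ → |t| < r * θ →
          (∀ e, e ≠ b → V e = U e) → V b = U b * expPt (s • v) → (∀ e, e ≠ b' → Z e = V e) → Z b' = V b' * expPt (t • v') →
          g ((s : ℂ), (t : ℂ)) = ((f Z : ℝ) : ℂ)) ∧
        ∀ z ∈ Metric.ball (0 : ℂ) (r * θ) ×ˢ Metric.ball (0 : ℂ) (r * θ), ‖g z - g 0‖ ≤ B

/-- S1aᴴ · RUN CLASS MEMBERSHIP WITH ANALYTICITY — S1a `RunClassMembership` (v17.2 :211) VERBATIM plus, for the SAME density `ρ`, the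
per-height (β) clause at window parameter `49∕50·θBal` (v0.4; was `θBal∕2`) with a radius `rA > 0` and the print-shaped oscillation bound `CB·β_j·θ_j² = CB·p(g_j)²`
(LEAD spec §1 caveat: the honest oscillation of `log ρ_j` on the `rA·θ_j`-bidisc is `≍ rA·p(g_j)²`), `rA, CB` chosen with `(j₀, prm)` (before the runs), normalised TEXT-SIDE (LEAD w3 g24 №15 (A) N2 ruling, v0.3): `rA ≤ 1∕12` and
`0 < CB` (analyticity at radius `rA` restricts to any smaller radius; `CB ↦ max CB 1`) so the composition feeds ✓px5 `seedTriple_of_seed_of_analytic_three`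
by `exact`.
`RunClassMembershipH → RunClassMembership` by dropping the conjunct.  L (print: [Balaban1985UV3] p.263 (c), analyticity of the effective
densities on the complexified small-field domain; the stub is the v18 L-debt `stub_runClassMembershipH`). -/
def RunClassMembershipH : Prop :=
  ∀ (L : ℕ), ∃ pm : ℝ, 0 < pm ∧ ∀ (p₀ : ℝ), pm ≤ p₀ → ∃ b₀ : ℝ, 0 < b₀ ∧ ∃ γ₁ : ℝ, 0 < γ₁ ∧ ∀ (F : T3Family) (γ : ℝ), F.L = L → 0 < γ → γ ≤ γ₁ →
    ∃ (j₀ : ℕ) (prm : ℕ → ClassParams) (rA CB : ℝ), AdmissibleClassParams F γ b₀ p₀ prm ∧ 0 < rA ∧ rA ≤ 1 / 12 ∧ 0 < CB ∧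
      ∀ (ν : ℕ → (j : ℕ) → Measure (GaugeField (F.P j) 0 (Matrix.specialUnitaryGroup (Fin 2) ℂ))),
        (∀ K, ν K K = T4GenFunBounds.gibbsMeasure (F.P K) ((F.scheme ℰp γ).β K)) →
        (∀ K j, j < K → ν K j = Measure.map (descend F ℰp j) (ν K (j + 1))) →
        ∀ (K Ts : ℕ), Ts ≤ K → ∀ (μ : (j : ℕ) → Measure (GaugeField (F.P j) 0 (Matrix.specialUnitaryGroup (Fin 2) ℂ))),
          (∀ j, Ts ≤ j → μ j = ν K j) →
          (∀ j, j < Ts → μ j = Measure.map (descend F ℰp j) ((μ (j + 1)).withDensity (fun U => ENNReal.ofReal (sfCut (θBal F.L γ b₀ p₀ (j + 1)) U)))) →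
          ∃ ρ : (j : ℕ) → GaugeField (F.P j) 0 (Matrix.specialUnitaryGroup (Fin 2) ℂ) → ℝ,
            ∀ (j : ℕ) (hjK : j ≤ K), j₀ ≤ j →
              (∀ U, PlaqSmall (θBal F.L γ b₀ p₀ j) U → 0 < ρ j U) ∧
              μ j = (fieldMeasure _ _ _).withDensity (fun U => ENNReal.ofReal (ρ j U)) ∧
              (∃ κ : ℝ, MemOfRun F ℰp hjK (prm j) (fun U => Real.exp κ * ρ j U)) ∧
              ContinuousOn (ρ j) {U | PlaqSmall (θBal F.L γ b₀ p₀ j) U} ∧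
              AnalyticPairWindowAt (49 / 50 * θBal F.L γ b₀ p₀ j) rA (CB * (((F.L : ℝ) ^ j / γ) * θBal F.L γ b₀ p₀ j ^ 2)) (fun U => Real.log (ρ j U))

/-- O1ᵘ-H v2.2 · UNIFORM MULTI-STEP (DIRECT) TRANSPORT in the Hessian currency (see the module doc for the four conventions; v0.5: head
`∃ pW, … pW ≤ p₀ →` «TN-TAIL-P0», as in `BackwardStabilityFinSupH`). XL; NOT PRINTED as a theorem — [Balaban1985UV3] p.263 (c) + [Balaban1988RG2]
(0.3)–(0.12) give the analyticity∕localisation it would be assembled from. -/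
def OneStepTransportUH : Prop :=
  ∃ pW : ℝ, ∃ γ₁ : ℝ, 0 < γ₁ ∧ ∀ (F : T3Family) (γ : ℝ), 0 < γ → γ ≤ γ₁ →
  ∀ (b₀ p₀ : ℝ) (j₀ : ℕ) (prm : ℕ → ClassParams) (η : ℕ → ℝ) (rA : ℝ) (Bρ : ℕ → ℝ), 0 < b₀ → 0 < p₀ → pW ≤ p₀ → AdmissibleClassParams F γ b₀ p₀ prm →
  (∀ j, 0 ≤ η j) → Summable η → Summable (fun i => ∑' k, η (k + i)) →
  Tendsto (fun j => (∑' k, η (k + j)) * ((1 + 2 * ((F.L : ℝ) ^ j / γ) * (Fintype.card (Plaq (F.P j) 0) : ℝ)) * (Fintype.card (PBond (F.P j) 0) : ℝ) ^ 2)) atTop (𝓝 0) →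
  0 < rA →
  ∃ κ₀ : ℝ, 0 < κ₀ ∧ ∀ (κ : ℝ), 0 < κ → κ ≤ κ₀ →
  ∃ (θ r Ctr C w₀ : ℝ) (εd δ : ℕ → ℝ) (j₁ : ℕ), 0 < θ ∧ 0 < r ∧ 1 ≤ Ctr ∧ 0 ≤ C ∧ 0 < w₀ ∧ (∀ j, 0 ≤ εd j ∧ 0 ≤ δ j) ∧ Summable εd ∧ Summable δ ∧
  Summable (fun i => ∑' k, δ (k + i)) ∧
  Tendsto (fun j => (∑' k, δ (k + j)) * ((1 + 2 * ((F.L : ℝ) ^ j / γ) * (Fintype.card (Plaq (F.P j) 0) : ℝ)) * (Fintype.card (PBond (F.P j) 0) : ℝ) ^ 2)) atTop (𝓝 0) ∧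
  j₀ ≤ j₁ ∧
  ∀ (ν : ℕ → (j : ℕ) → MeasureTheory.Measure (GaugeField (F.P j) 0 ↥(Matrix.specialUnitaryGroup (Fin 2) ℂ))),
  (∀ K, ν K K = T4GenFunBounds.gibbsMeasure (F.P K) ((F.scheme ℰp γ).β K)) →
  (∀ K j, j < K → ν K j = Measure.map (descend F ℰp j) (ν K (j + 1))) →
  ∀ (K K' : ℕ), K ≤ K' → ∀ (Ts T : ℕ), Ts < T → T ≤ K →
  ∀ (μ μ' : ((j : ℕ) → MeasureTheory.Measure (GaugeField (F.P j) 0 ↥(Matrix.specialUnitaryGroup (Fin 2) ℂ))))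
    (ρ ρ' : ((j : ℕ) → GaugeField (F.P j) 0 ↥(Matrix.specialUnitaryGroup (Fin 2) ℂ) → ℝ)),
  (∀ j : ℕ, Ts ≤ j → j ≤ T → μ j = ν K j ∧ μ' j = ν K' j) →
  (∀ j : ℕ, j < Ts → μ j = Measure.map (descend F ℰp j) ((μ (j + 1)).withDensity (fun U => ENNReal.ofReal (sfCut (θBal F.L γ b₀ p₀ (j + 1)) U))) ∧
    μ' j = Measure.map (descend F ℰp j) ((μ' (j + 1)).withDensity (fun U => ENNReal.ofReal (sfCut (θBal F.L γ b₀ p₀ (j + 1)) U)))) →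
  (∀ j : ℕ, Ts ≤ j → j < T → μ j = Measure.map (descend F ℰp j) (μ (j + 1)) ∧ μ' j = Measure.map (descend F ℰp j) (μ' (j + 1))) →
  (∀ j : ℕ, j ≤ T → IsFiniteMeasure (μ j) ∧ IsFiniteMeasure (μ' j)) →
  (∀ j : ℕ, j₀ ≤ j → j ≤ T → ((∀ U, PlaqSmall (θBal F.L γ b₀ p₀ j) U → 0 < ρ j U ∧ 0 < ρ' j U) ∧
    μ j = (fieldMeasure _ _ _).withDensity (fun U => ENNReal.ofReal (ρ j U)) ∧ μ' j = (fieldMeasure _ _ _).withDensity (fun U => ENNReal.ofReal (ρ' j U)) ∧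
    (∃ κ : ℝ, MemAtHeight F ℰp j (prm j) (fun U => Real.exp κ * ρ j U)) ∧ (∃ κ : ℝ, MemAtHeight F ℰp j (prm j) (fun U => Real.exp κ * ρ' j U)) ∧
    μ j {U | ¬ PlaqSmall (θBal F.L γ b₀ p₀ j) U} ≤ ENNReal.ofReal (η j) ∧ μ' j {U | ¬ PlaqSmall (θBal F.L γ b₀ p₀ j) U} ≤ ENNReal.ofReal (η j) ∧
    (ContinuousOn (ρ j) {U | PlaqSmall (θBal F.L γ b₀ p₀ j) U} ∧ ContinuousOn (ρ' j) {U | PlaqSmall (θBal F.L γ b₀ p₀ j) U}) ∧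
    (AnalyticPairWindowAt (49 / 50 * θBal F.L γ b₀ p₀ j) rA (Bρ j) (fun U => Real.log (ρ j U)) ∧
      AnalyticPairWindowAt (49 / 50 * θBal F.L γ b₀ p₀ j) rA (Bρ j) (fun U => Real.log (ρ' j U))))) →
  ∀ (w : ℝ), 0 ≤ w → w / (((F.L : ℝ) ^ Ts / γ) * θBal F.L γ b₀ p₀ Ts ^ 2) ≤ w₀ →
  (∃ k : PBond (F.P Ts) 0 → PBond (F.P Ts) 0 → ℝ, (∀ b b', 0 ≤ k b b') ∧
    (∀ b, ∑ b', k b b' * Real.exp (κ * (b.src.tdist b'.src : ℝ)) ≤ w) ∧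
    HClauseSq (θBal F.L γ b₀ p₀ Ts / 4) (rA / 2) k (fun U => Real.log (ρ Ts U) - Real.log (ρ' Ts U))) →
  ∀ (j : ℕ), j₁ ≤ j → j + 1 ≤ Ts →
  ∃ (c' : Plaq (F.P j) 0 → ℝ) (a' w' : ℝ), 0 ≤ a' ∧ 0 ≤ w' ∧
    a' + θ * (w' / (((F.L : ℝ) ^ j / γ) * θBal F.L γ b₀ p₀ j ^ 2)) ≤
      (Ctr + εd (T - (Ts + 1)) + C * (w / (((F.L : ℝ) ^ Ts / γ) * θBal F.L γ b₀ p₀ Ts ^ 2))) *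
        (w / (((F.L : ℝ) ^ Ts / γ) * θBal F.L γ b₀ p₀ Ts ^ 2)) + δ j ∧
    (∀ p, |c' p| ≤ a') ∧
    ∃ k' : PBond (F.P j) 0 → PBond (F.P j) 0 → ℝ, (∀ b b', 0 ≤ k' b b') ∧
      (∀ b, ∑ b', k' b b' * Real.exp (κ * (b.src.tdist b'.src : ℝ)) ≤ w') ∧
      HClauseSq (θBal F.L γ b₀ p₀ j / 4) r k'
        (fun U => Real.log (ρ j U) - Real.log (ρ' j U) - ((F.L : ℝ) ^ j / γ) * ∑ p, c' p * (1 - reTr (GaugeField.plaqHol U p)))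

/-- S3ᴴ · BACKWARD STABILITY ON FINITE RUNS, H-CURRENCY, SUP-OSCILLATION FORM (TN-OSC): S3 v17.2's frame with (β) in block ⑧, the H-seed at
`T`, and the conclusion = the inner-window sup-oscillation of `h_j` relative to `1` at path profile `b₀∕8`, RHS `(Cs·x_T + δ j)·β_j·(2·#Plaq_j + #PBond_j²)` (v0.2: (P-b′) v1.1's θ-free count kills the `1∕θ_j`).
DERIVED (junction `directTransport_supR : OneStepTransportUH → BackwardStabilityFinSupH` over P-b′ + brick T + GRAnchorFree). NOT PRINTED. XL. -/
def BackwardStabilityFinSupH : Prop :=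
  ∃ pW : ℝ, ∃ γ₁ : ℝ, 0 < γ₁ ∧ ∀ (F : T3Family) (γ : ℝ), 0 < γ → γ ≤ γ₁ →
  ∀ (b₀ p₀ κ : ℝ) (j₀ : ℕ) (prm : ℕ → ClassParams) (η : ℕ → ℝ) (rA : ℝ) (Bρ : ℕ → ℝ), 0 < b₀ → 0 < p₀ → pW ≤ p₀ → AdmissibleClassParams F γ b₀ p₀ prm → 0 < κ →
  (∀ j, 0 ≤ η j) → Summable η → Summable (fun i => ∑' k, η (k + i)) →
  Tendsto (fun j => (∑' k, η (k + j)) * ((1 + 2 * ((F.L : ℝ) ^ j / γ) * (Fintype.card (Plaq (F.P j) 0) : ℝ)) * (Fintype.card (PBond (F.P j) 0) : ℝ) ^ 2)) atTop (𝓝 0) →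
  0 < rA →
  ∃ (Cs w₀ : ℝ) (δ : ℕ → ℝ) (j₁ : ℕ), 0 ≤ Cs ∧ 0 < w₀ ∧ (∀ j, 0 ≤ δ j) ∧ Summable δ ∧ Summable (fun i => ∑' k, δ (k + i)) ∧
  Tendsto (fun j => (∑' k, δ (k + j)) * ((1 + 2 * ((F.L : ℝ) ^ j / γ) * (Fintype.card (Plaq (F.P j) 0) : ℝ)) * (Fintype.card (PBond (F.P j) 0) : ℝ) ^ 2)) atTop (𝓝 0) ∧
  j₀ ≤ j₁ ∧
  ∀ (ν : ℕ → (j : ℕ) → MeasureTheory.Measure (GaugeField (F.P j) 0 ↥(Matrix.specialUnitaryGroup (Fin 2) ℂ))),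
  (∀ K, ν K K = T4GenFunBounds.gibbsMeasure (F.P K) ((F.scheme ℰp γ).β K)) →
  (∀ K j, j < K → ν K j = Measure.map (descend F ℰp j) (ν K (j + 1))) →
  ∀ (K K' : ℕ), K ≤ K' → ∀ (T Tt : ℕ), T < Tt → Tt ≤ K →
  ∀ (μ μ' : ((j : ℕ) → MeasureTheory.Measure (GaugeField (F.P j) 0 ↥(Matrix.specialUnitaryGroup (Fin 2) ℂ))))
    (ρ ρ' : ((j : ℕ) → GaugeField (F.P j) 0 ↥(Matrix.specialUnitaryGroup (Fin 2) ℂ) → ℝ)),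
  (∀ j : ℕ, T ≤ j → j ≤ Tt → μ j = ν K j ∧ μ' j = ν K' j) →
  (∀ j : ℕ, j < T → μ j = Measure.map (descend F ℰp j) ((μ (j + 1)).withDensity (fun U => ENNReal.ofReal (sfCut (θBal F.L γ b₀ p₀ (j + 1)) U))) ∧
    μ' j = Measure.map (descend F ℰp j) ((μ' (j + 1)).withDensity (fun U => ENNReal.ofReal (sfCut (θBal F.L γ b₀ p₀ (j + 1)) U)))) →
  (∀ j : ℕ, T ≤ j → j < Tt → μ j = Measure.map (descend F ℰp j) (μ (j + 1)) ∧ μ' j = Measure.map (descend F ℰp j) (μ' (j + 1))) →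
  (∀ j : ℕ, j ≤ Tt → IsFiniteMeasure (μ j) ∧ IsFiniteMeasure (μ' j)) →
  (∀ j : ℕ, j₀ ≤ j → j ≤ Tt → ((∀ U, PlaqSmall (θBal F.L γ b₀ p₀ j) U → 0 < ρ j U ∧ 0 < ρ' j U) ∧
    μ j = (fieldMeasure _ _ _).withDensity (fun U => ENNReal.ofReal (ρ j U)) ∧ μ' j = (fieldMeasure _ _ _).withDensity (fun U => ENNReal.ofReal (ρ' j U)) ∧
    (∃ κ : ℝ, MemAtHeight F ℰp j (prm j) (fun U => Real.exp κ * ρ j U)) ∧ (∃ κ : ℝ, MemAtHeight F ℰp j (prm j) (fun U => Real.exp κ * ρ' j U)) ∧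
    μ j {U | ¬ PlaqSmall (θBal F.L γ b₀ p₀ j) U} ≤ ENNReal.ofReal (η j) ∧ μ' j {U | ¬ PlaqSmall (θBal F.L γ b₀ p₀ j) U} ≤ ENNReal.ofReal (η j) ∧
    (ContinuousOn (ρ j) {U | PlaqSmall (θBal F.L γ b₀ p₀ j) U} ∧ ContinuousOn (ρ' j) {U | PlaqSmall (θBal F.L γ b₀ p₀ j) U}) ∧
    (AnalyticPairWindowAt (49 / 50 * θBal F.L γ b₀ p₀ j) rA (Bρ j) (fun U => Real.log (ρ j U)) ∧
      AnalyticPairWindowAt (49 / 50 * θBal F.L γ b₀ p₀ j) rA (Bρ j) (fun U => Real.log (ρ' j U))))) →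
  ∀ (wT : ℝ), 0 ≤ wT → wT / (((F.L : ℝ) ^ T / γ) * θBal F.L γ b₀ p₀ T ^ 2) ≤ w₀ →
  (∃ kT : PBond (F.P T) 0 → PBond (F.P T) 0 → ℝ, (∀ b b', 0 ≤ kT b b') ∧
    (∀ b, ∑ b', kT b b' * Real.exp (κ * (b.src.tdist b'.src : ℝ)) ≤ wT) ∧
    HClauseSq (θBal F.L γ b₀ p₀ T / 4) (rA / 2) kT (fun U => Real.log (ρ T U) - Real.log (ρ' T U))) →
  ∀ (j : ℕ), j₁ ≤ j → j ≤ T →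
  ∀ U : GaugeField (F.P j) 0 ↥(Matrix.specialUnitaryGroup (Fin 2) ℂ), PlaqSmall (θBal F.L γ (Real.sqrt (b₀ / 8)) (p₀ / 2) j) U →
    |(Real.log (ρ j U) - Real.log (ρ' j U)) - (Real.log (ρ j 1) - Real.log (ρ' j 1))| ≤
      (Cs * (wT / (((F.L : ℝ) ^ T / γ) * θBal F.L γ b₀ p₀ T ^ 2)) + δ j) *
        (((F.L : ℝ) ^ j / γ) * (2 * (Fintype.card (Plaq (F.P j) 0) : ℝ) + (Fintype.card (PBond (F.P j) 0) : ℝ) ^ 2))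

/-- Sanity: S1aᴴ implies S1a's text (v17.2 :211) — dropping the (β) conjunct. -/
theorem runClassMembership_of_H (h : RunClassMembershipH) :
    ∀ (L : ℕ), ∃ pm : ℝ, 0 < pm ∧ ∀ (p₀ : ℝ), pm ≤ p₀ → ∃ b₀ : ℝ, 0 < b₀ ∧ ∃ γ₁ : ℝ, 0 < γ₁ ∧ ∀ (F : T3Family) (γ : ℝ), F.L = L → 0 < γ → γ ≤ γ₁ →
    ∃ (j₀ : ℕ) (prm : ℕ → ClassParams), AdmissibleClassParams F γ b₀ p₀ prm ∧
      ∀ (ν : ℕ → (j : ℕ) → Measure (GaugeField (F.P j) 0 (Matrix.specialUnitaryGroup (Fin 2) ℂ))),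
        (∀ K, ν K K = T4GenFunBounds.gibbsMeasure (F.P K) ((F.scheme ℰp γ).β K)) →
        (∀ K j, j < K → ν K j = Measure.map (descend F ℰp j) (ν K (j + 1))) →
        ∀ (K Ts : ℕ), Ts ≤ K → ∀ (μ : (j : ℕ) → Measure (GaugeField (F.P j) 0 (Matrix.specialUnitaryGroup (Fin 2) ℂ))),
          (∀ j, Ts ≤ j → μ j = ν K j) →
          (∀ j, j < Ts → μ j = Measure.map (descend F ℰp j) ((μ (j + 1)).withDensity (fun U => ENNReal.ofReal (sfCut (θBal F.L γ b₀ p₀ (j + 1)) U)))) →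
          ∃ ρ : (j : ℕ) → GaugeField (F.P j) 0 (Matrix.specialUnitaryGroup (Fin 2) ℂ) → ℝ,
            ∀ (j : ℕ) (hjK : j ≤ K), j₀ ≤ j →
              (∀ U, PlaqSmall (θBal F.L γ b₀ p₀ j) U → 0 < ρ j U) ∧
              μ j = (fieldMeasure _ _ _).withDensity (fun U => ENNReal.ofReal (ρ j U)) ∧
              (∃ κ : ℝ, MemOfRun F ℰp hjK (prm j) (fun U => Real.exp κ * ρ j U)) ∧
              ContinuousOn (ρ j) {U | PlaqSmall (θBal F.L γ b₀ p₀ j) U} := by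
  intro L
  obtain ⟨pm, hpm, H⟩ := h L
  refine ⟨pm, hpm, fun p₀ hp => ?_⟩
  obtain ⟨b₀, hb₀, γ₁, hγ₁, H1⟩ := H p₀ hp
  refine ⟨b₀, hb₀, γ₁, hγ₁, fun F γ hL hγ hγ₁ => ?_⟩
  obtain ⟨j₀, prm, rA, CB, hadm, _, _, _, H2⟩ := H1 F γ hL hγ hγ₁
  refine ⟨j₀, prm, hadm, fun ν hν1 hν2 K Ts hTs μ hμ1 hμ2 => ?_⟩
  obtain ⟨ρ, hρ⟩ := H2 ν hν1 hν2 K Ts hTs μ hμ1 hμ2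
  exact ⟨ρ, fun j hjK hj => ⟨(hρ j hjK hj).1, (hρ j hjK hj).2.1, (hρ j hjK hj).2.2.1, (hρ j hjK hj).2.2.2.1⟩⟩

end Summit.QuantumFields.YangMills.Cruxes.FluctuationComparisonRegPrIntL.V18Draft
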